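import Literature.NumberTheory.EllipticCurves.FineSelmerUpstairsSubgroupModelProofs
import Literature.NumberTheory.EllipticCurves.FineSelmerClassGroupCriterion
import Literature.NumberTheory.EllipticCurves.IwasawaCyclotomicProofs
import Literature.NumberTheory.EllipticCurves.DivisionField
import Literature.NumberTheory.GaloisRepresentations.LocalKroneckerWeberInertiaProofs
import Mathlib.FieldTheory.Normal.Closure
import HarnessLib

/-!
# Lim 2017 Thm. 3.5 at `p = 2`, UPSTAIRS over `K(E[2], μ_{2^∞})`, is a TREE THEOREM: discharge of the named fact
# `Lim2017.thm35_at_two_upstairs_fineSelmer_twoTorsion_finite_of_classicalMuVanishes`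

`Proofs`-style file (theorems only: no definition, no named fact, no `sorry`) in topic `NumberTheory/EllipticCurves`
(helper namespace `Literature.NumberTheory.EllipticCurves.FineSelmerUpstairs`; the discharge lives in the namespace
`Literature.NumberTheory.EllipticCurves.Lim2017` of the named fact, file `FineSelmerClassGroupCriterion.lean`), written by the
prover seat `cruxlead-stmt-BirchSwinnertonDyer-19573-w2` GEN 6 (cell `bsd-2adic`; `--supports` stmt-BirchSwinnertonDyer-19573, the
crux 202 `OrdKatoHalfAtTwoIso` of K4 `ByReductionTypeAtTwo`, whose registered stub `stub_lemma46_limUp` (skeleton v19) carries this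
fact as its second conjunct; the same fact is the door of stub Limʳ `stub_limRelAtTwo` of crux C2 stmt-BirchSwinnertonDyer-22298
(`…FineRoadLimRelUpstairs.limRelAtTwo_of_lim2017`) and of the relaxed `(A₂)` supply of the B7′ child stmt-BirchSwinnertonDyer-23921).
Sequel of `FineSelmerUpstairsSubgroupModelProofs.lean` (§1–§2 there). Closes nothing; Conjecture A is proved for no curve
unconditionally (the input is Iwasawa's classical `μ₂ = 0` for `K(E[2], √−1)^{cyc}`); BSD is not proved by any of this.

## The theorem (`Lim2017.thm35_at_two_upstairs_fineSelmer_twoTorsion_finite_of_classicalMuVanishes_holds`)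

For every elliptic `W/ℚ` and `i ∈ ℚ̄` with `i² = −1`: if Iwasawa's classical `μ` vanishes (growth form, `ClassicalMuVanishes`)
for every cyclotomic `ℤ₂`-extension of `L = ℚ(E[2]) ⊔ ℚ⟮i⟯ = ℚ(E[2], √−1)`, then the fine (everywhere locally trivial) Selmer
group of `E[2^∞]` over `Ω = ker ρ̄_{E,2} ⊓ ker χ₂ = Gal(ℚ̄/ℚ(E[2], μ_{2^∞}))` has FINITE `2`-torsion — Coates–Sujatha's
statement (A) for `E` over `L^{cyc} = ℚ(E[2], μ_{2^∞})` in Greenberg's intrinsic `Sel₀[2]`-form, exactly as typed. Proved for `E`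
over ANY number field `K` (§3, `finite_strictFine_twoTorsion_upstairs_of_classicalMuVanishes`); §4 is `K = ℚ`.

## Proof

* §2 of the prequel: statement (A) upstairs in the subgroup model `H¹(galImage(ker κ_L), E[p^∞])` over a totally complex
  `L ⊇ K(E[p])` from `ClassicalMuVanishes κ_L` (any `K`, `p`).
* §3 (any number field `K`, `p = 2`, `i ∈ K̄` with `i² = −1`): **`galImage(ker κ_L) = ker ρ̄_{E,2} ⊓ ker χ₂` for
  `L = K(E[2]) ⊔ K⟮i⟯`**, element-wise: `ker κ_L = χ_{2,L}⁻¹(μ(ℤ₂))` and `χ_{2,K} ∘ res = χ_{2,L}` (`cyclotomicCharacter_absGaloisRestrict`),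
  `res(Γ_L) = Gal(K̄/L)` (`L/K` normal — `K(E[2])` is Galois, `K⟮i⟯` is normal (`normal_adjoin_of_sq_eq_neg_one`), Mathlib
  `IntermediateField.normal_sup`; tree `range_absGaloisRestrict_eq_fixingSubgroup`), `Gal(K̄/L) = Gal(K̄/K(E[2])) ⊓ Gal(K̄/K⟮i⟯)`
  (Mathlib `IntermediateField.fixingSubgroup_sup`, tree `WeierstrassCurve.fixingSubgroup_divisionField`), and on `Γ_K`: «`σ` fixes `i`
  and `χ₂(σ) ∈ μ(ℤ₂)` ⟺ `χ₂(σ) = 1`» (`σ • i = i^{χ₂(σ) mod 4}` by `GaloisRep.cyclotomicCharacter_spec`, `i` a primitive fourth root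
  of unity; `μ(ℤ₂) = {±1}` by `PadicInt.torsion_units_le_rootsOfUnity`). `L` is totally complex (`i² = −1` has no real embedding) and
  `Γ_L` fixes `E[2]`, so §2 applies with `Ω = ker ρ̄_{E,2} ⊓ ker χ₂`: **`finite_strictFine_twoTorsion_upstairs_of_classicalMuVanishes`**,
  the typed statement for `E` over ANY number field `K`; §4 is its specialisation `K = ℚ` — the named fact VERBATIM (the generic base
  keeps every instance on `K̄` and on the intermediate fields on the single `AlgebraicClosure.instAlgebra` path; at `K = ℚ` the
  `ℚ`-algebra instances found by class inference differ from these only up to definitional unfolding, which the final `exact` absorbs).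

References: [Lim2017FineSelmer] M. F. Lim, *Notes on the fine Selmer groups*, Asian J. Math. 21 (2017) = arXiv:1306.2047, §3
Thm. 3.5, Lemma 3.2, proof of Thm. 3.1 («so that `F` contains `μ_{2p}`»); [CoatesSujatha2005] J. Coates, R. Sujatha, Math. Ann.
331 (2005), §3 Thm. 3.4 (proof), Lemma 3.3; [Serre1968] Ch. I §1.2 (cyclotomic character); [Serre1973] Ch. II §3 (units of `ℤ₂`);
[Washington1997] §13.1; [SilvermanAEC2009] VIII.§1; [MilneFT2022] Ch. 3, Ch. 7; [Lang1990] Ch. 5 §§1–4.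
-/

set_option autoImplicit false

noncomputable section

open scoped Classical Pointwise

namespace Literature.NumberTheory.EllipticCurves.FineSelmerUpstairs

open NumberField IsDedekindDomain Field _root_.WeierstrassCurve
open Literature.NumberTheory.EllipticCurves Literature.NumberTheory.EllipticCurves.GreenbergSelmer
  Literature.NumberTheory.EllipticCurves.FineSelmerTrivialisingRestriction
  Literature.NumberTheory.GaloisRepresentations Literature.NumberTheory.IwasawaTheory

/-! ## §3 `p = 2` over any number field `K`: the carrier `L = K(E[2]) ⊔ K⟮i⟯` and the identity `galImage(ker κ_L) = ker ρ̄_{E,2} ⊓ ker χ₂` -/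

section Two

open IntermediateField

/-- **The torsion of `ℤ₂ˣ` is `{±1}`** (a unit of finite order is a square root of unity: `PadicInt.torsion_units_le_rootsOfUnity`,
`#μ(ℤ₂) = φ(4) = 2`, and `ℤ₂` is a domain). The Summits-side `…FineRoadOddSplit.eq_one_or_eq_neg_one_of_mem_torsion` (cell
bsd-f1-sign2) verbatim, re-homed here so that this Literature file does not import a Theorems file. [cite: Serre1973, Ch. II §3.1 Prop. 7, §3.2 Prop. 8] -/
theorem units_eq_one_or_eq_neg_one_of_mem_torsion_two {u : ℤ_[2]ˣ} (hu : u ∈ CommGroup.torsion ℤ_[2]ˣ) :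
    u = 1 ∨ u = -1 := by
  have h := PadicInt.torsion_units_le_rootsOfUnity (p := 2) hu
  have ht : torsionOrder 2 = 2 := by
    show Nat.totient (2 ^ (if (2 : ℕ) = 2 then 2 else 1)) = 2
    rw [if_pos rfl, Nat.totient_prime_pow Nat.prime_two two_pos]
    norm_num
  rw [ht, mem_rootsOfUnity] at h
  have h' : ((u : ℤ_[2]ˣ) : ℤ_[2]) ^ 2 = 1 := by
    rw [← Units.val_pow_eq_pow_val, h, Units.val_one]
  rcases sq_eq_one_iff.mp h' with h1 | h1
  · exact Or.inl (Units.ext h1)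
  · exact Or.inr (Units.ext (by rw [h1, Units.val_neg, Units.val_one]))

variable {K : Type} [Field K]

/-- The powers `iⁿ`, `n < 4`, of a square root `i` of `−1` equal `i` only for `n = 1` (characteristic `0`: `i` is a PRIMITIVE fourth
root of unity). [folklore] -/
private theorem pow_eq_self_iff_of_sq_eq_neg_one [CharZero K] (i : AlgebraicClosure K) (hi : i ^ 2 = -1) {n : ℕ} (hn : n < 4) :
    i ^ n = i ↔ n = 1 := by
  have h2 : (2 : AlgebraicClosure K) ≠ 0 := two_ne_zero
  have hi1 : i ≠ 1 := by
    intro h; rw [h, one_pow] at hi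
    exact h2 (by linear_combination hi)
  have hi0 : i ≠ 0 := by
    intro h; rw [h, zero_pow two_ne_zero] at hi
    exact one_ne_zero (by linear_combination hi)
  interval_cases n
  · rw [pow_zero]
    exact ⟨fun h ↦ (hi1 h.symm).elim, fun h ↦ by omega⟩
  · simp
  · rw [hi]
    refine ⟨fun h ↦ ?_, fun h ↦ by omega⟩
    exfalso
    have h1 : i ^ 2 = 1 := by rw [← h]; norm_num
    rw [hi] at h1
    exact h2 (by linear_combination -h1)
  · refine ⟨fun h ↦ ?_, fun h ↦ by omega⟩
    exfalso
    have h3 : i ^ 3 = -i := by rw [pow_succ, hi]; ring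
    rw [h3] at h
    have h4 : (2 : AlgebraicClosure K) * i = 0 := by linear_combination -h
    exact hi0 ((mul_eq_zero.1 h4).resolve_left h2)

/-- **`σ • i = i ↔ χ₂(σ) ≡ 1 (mod 4)`** for `σ ∈ Γ_K` and `i² = −1` (characteristic `0`): `σ • i = i^{χ₂(σ) mod 4}`
(`GaloisRep.cyclotomicCharacter_spec` with `i^{2²} = 1`), and `iⁿ = i` iff `n ≡ 1 (mod 4)`.
[cite: Serre1968, Ch. I §1.2 (the cyclotomic character)] -/
theorem smul_eq_self_iff_toZModPow_two_cyclotomicCharacter_eq_one [CharZero K] (i : AlgebraicClosure K) (hi : i ^ 2 = -1)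
    (σ : absoluteGaloisGroup K) :
    σ • i = i ↔ PadicInt.toZModPow 2 ((GaloisRep.cyclotomicCharacter K 2 σ : ℤ_[2]ˣ) : ℤ_[2]) = 1 := by
  haveI : NeZero ((2 : ℕ) : K) := ⟨by exact_mod_cast (two_ne_zero : (2 : K) ≠ 0)⟩
  haveI : Fact (1 < 2 ^ 2) := ⟨by norm_num⟩
  have h4 : i ^ 2 ^ 2 = 1 := by
    rw [show (2 : ℕ) ^ 2 = 2 * 2 by norm_num, pow_mul, hi]; norm_num
  have hspec := GaloisRep.cyclotomicCharacter_spec K 2 (k := 2) σ i h4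
  have hlt := ZMod.val_lt (PadicInt.toZModPow 2 ((GaloisRep.cyclotomicCharacter K 2 σ : ℤ_[2]ˣ) : ℤ_[2]))
  have key := pow_eq_self_iff_of_sq_eq_neg_one i hi (n := (PadicInt.toZModPow 2
    ((GaloisRep.cyclotomicCharacter K 2 σ : ℤ_[2]ˣ) : ℤ_[2])).val) (by simpa using hlt)
  constructor
  · intro h
    rw [h] at hspec
    have hn := key.1 hspec.symm
    exact (ZMod.val_injective (2 ^ 2)) (by rw [hn, ZMod.val_one])
  · intro h
    rw [hspec]
    have hn : (PadicInt.toZModPow 2 ((GaloisRep.cyclotomicCharacter K 2 σ : ℤ_[2]ˣ) : ℤ_[2])).val = 1 := by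
      rw [h, ZMod.val_one]
    exact key.2 hn

/-- **`σ` fixes `i` and `χ₂(σ)` is torsion ⟹ `χ₂(σ) = 1`** (`i² = −1`, characteristic `0`): an element fixing `i` has `χ₂ ≡ 1 (mod 4)`,
and the only torsion unit of `ℤ₂` congruent to `1 (mod 4)` is `1` (`μ(ℤ₂) = {±1}`). This is the element-wise content of
`Gal(K̄/K(i)·K_∞) = ker χ₂`, `K_∞` the cyclotomic `ℤ₂`-extension (`ker κ = χ₂⁻¹(μ(ℤ₂))`, `ZpExtension.IsCyclotomic`).
[cite: Washington1997, §13.1] [cite: Serre1973, Ch. II §3.2 Prop. 8] -/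
theorem cyclotomicCharacter_eq_one_of_smul_eq_self_of_mem_torsion [CharZero K] (i : AlgebraicClosure K) (hi : i ^ 2 = -1)
    {σ : absoluteGaloisGroup K} (hfix : σ • i = i) (htors : GaloisRep.cyclotomicCharacter K 2 σ ∈ CommGroup.torsion ℤ_[2]ˣ) :
    GaloisRep.cyclotomicCharacter K 2 σ = 1 := by
  rcases units_eq_one_or_eq_neg_one_of_mem_torsion_two htors with h | h
  · exact h
  · exfalso
    have h4 := (smul_eq_self_iff_toZModPow_two_cyclotomicCharacter_eq_one i hi σ).1 hfix
    rw [h, Units.val_neg, Units.val_one, map_neg, map_one] at h4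
    exact absurd h4 (by decide)

/-- Conversely, **`χ₂(σ) = 1 ⟹ σ` fixes `i`** (`i² = −1`). [cite: Serre1968, Ch. I §1.2] -/
theorem smul_eq_self_of_cyclotomicCharacter_eq_one [CharZero K] (i : AlgebraicClosure K) (hi : i ^ 2 = -1)
    {σ : absoluteGaloisGroup K} (h : GaloisRep.cyclotomicCharacter K 2 σ = 1) : σ • i = i := by
  rw [smul_eq_self_iff_toZModPow_two_cyclotomicCharacter_eq_one i hi σ, h, Units.val_one, map_one]

/-- `σ ∈ Gal(E/F⟮a⟯) ↔ σ a = a` (the fixing subgroup of a simple adjunction is the stabiliser of the generator).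
[cite: MilneFT2022, Ch. 7 (the Galois correspondence)] -/
theorem mem_fixingSubgroup_adjoin_simple_iff {F E : Type*} [Field F] [Field E] [Algebra F E] (a : E) (σ : E ≃ₐ[F] E) :
    σ ∈ (IntermediateField.adjoin F ({a} : Set E)).fixingSubgroup ↔ σ a = a := by
  constructor
  · intro h
    exact (IntermediateField.mem_fixingSubgroup_iff _ _).1 h a (IntermediateField.mem_adjoin_simple_self F a)
  · intro h
    have hz : Subgroup.zpowers σ ≤ (IntermediateField.adjoin F ({a} : Set E)).fixingSubgroup := by
      rw [← IntermediateField.le_iff_le, IntermediateField.adjoin_simple_le_iff, IntermediateField.mem_fixedField_iff]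
      intro τ hτ
      have hst : Subgroup.zpowers σ ≤ MulAction.stabilizer (E ≃ₐ[F] E) a := by
        rw [Subgroup.zpowers_le, MulAction.mem_stabilizer_iff]; exact h
      exact hst hτ
    exact hz (Subgroup.mem_zpowers σ)

/-- `F⟮i⟯/F` is normal (`i² = −1`): every `F`-embedding `F̄ → F̄` maps `i` to `±i ∈ F⟮i⟯` (Mathlib
`IntermediateField.normal_iff_forall_map_le`). [cite: MilneFT2022, Ch. 3 (normal extensions)] -/
theorem normal_adjoin_of_sq_eq_neg_one (i : AlgebraicClosure K) (hi : i ^ 2 = -1) :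
    Normal K (IntermediateField.adjoin K ({i} : Set (AlgebraicClosure K))) := by
  refine IntermediateField.normal_iff_forall_map_le.2 fun σ ↦ ?_
  rw [IntermediateField.adjoin_map, Set.image_singleton, IntermediateField.adjoin_simple_le_iff]
  have hσ : (σ i) ^ 2 = i ^ 2 := by rw [← map_pow, hi, map_neg, map_one]
  rcases eq_or_eq_neg_of_sq_eq_sq _ _ hσ with h | h
  · rw [h]; exact IntermediateField.mem_adjoin_simple_self K i
  · rw [h]; exact neg_mem (IntermediateField.mem_adjoin_simple_self K i)

/-- An intermediate field `L ∋ i`, `i² = −1`, is totally complex (a real place would give a real number of square `−1`).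
[cite: Lim2017FineSelmer, §3 proof of Thm. 3.1 («so that F contains μ_{2p} (in particular, F has no real primes)»)] -/
theorem isComplex_of_mem_sq_eq_neg_one (i : AlgebraicClosure K) (hi : i ^ 2 = -1)
    (L : IntermediateField K (AlgebraicClosure K)) (hiL : i ∈ L) (w : InfinitePlace L) : w.IsComplex := by
  rw [← InfinitePlace.not_isReal_iff_isComplex]
  intro hw
  rw [InfinitePlace.isReal_iff] at hw
  have hsq : (⟨i, hiL⟩ : L) ^ 2 = -1 := Subtype.ext (by simpa using hi)
  have h1 : (hw.embedding ⟨i, hiL⟩) ^ 2 = -1 := by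
    rw [← map_pow, hsq, map_neg, map_one]
  nlinarith [sq_nonneg (hw.embedding ⟨i, hiL⟩)]

variable [NumberField K] (W : WeierstrassCurve K) [W.IsElliptic]

/-- **`res(Γ_L)` fixes `E[2]` for a normal `L ⊇ K(E[2])`** (`res(Γ_L) = Gal(K̄/L) ≤ Gal(K̄/K(E[2])) = Γ_{K(E[2])}`,
`range_absGaloisRestrict_eq_fixingSubgroup`, `WeierstrassCurve.fixingSubgroup_divisionField`). [cite: SilvermanAEC2009, VIII.§1] -/
theorem resGal_smul_geomTorsion_two_eq_self (L : IntermediateField K (AlgebraicClosure K)) [Normal K L]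
    (h2L : W.divisionField 2 ≤ L) (σ : absoluteGaloisGroup L) (P : geomTorsion W ((2 : ℕ) : ℤ)) :
    resGal (K := K) L σ • P = P := by
  have hmem : resGal (K := K) L σ ∈ (absGaloisRestrict K L).range := ⟨σ, rfl⟩
  rw [FineSelmerFiniteOfUnramifiedClasses.range_absGaloisRestrict_eq_fixingSubgroup L] at hmem
  have hle : L.fixingSubgroup ≤ (W.divisionField 2).fixingSubgroup := IntermediateField.fixingSubgroup_le h2L
  have hd : resGal (K := K) L σ ∈ fixingSubgroupOfModule K (geomTorsion W ((2 : ℕ) : ℤ)) := by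
    have h := W.fixingSubgroup_divisionField 2
    rw [SetLike.ext_iff] at h
    exact (h _).1 (hle hmem)
  exact (W.mem_fixingSubgroupOfModule_geomTorsion_iff 2).1 hd P

/-- **`galImage(ker κ_L) = ker ρ̄_{E,2} ⊓ ker χ₂`** for a cyclotomic `ℤ₂`-extension `κ_L` of `L = K(E[2]) ⊔ K⟮i⟯` (`i² = −1`):
the subgroup `res(Gal(L̄/L_∞)) ≤ Γ_K` consists of the `g` fixing `L` (`res(Γ_L) = Gal(K̄/L)`, `L/K` normal) with `χ₂(g)`
torsion (`ker κ_L = χ_{2,L}⁻¹(μ(ℤ₂))`, `χ_{2,K} ∘ res = χ_{2,L}`), i.e. fixing `E[2]` and `i` with `χ₂(g) ∈ {±1}`, i.e.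
`g ∈ ker ρ̄_{E,2}` with `χ₂(g) = 1` — `L_∞ = L·K_∞ = K(E[2], μ_{2^∞})`.
[cite: Washington1997, §13.1] [cite: Lim2017FineSelmer, §3 (the field F(μ_{2p}, T/𝔪T) and its cyclotomic extension)] -/
theorem galImage_kerSubgroup_eq (i : AlgebraicClosure K) (hi : i ^ 2 = -1)
    [Normal K ↥(W.divisionField 2 ⊔ IntermediateField.adjoin K ({i} : Set (AlgebraicClosure K)))]
    (κL : ZpExtension ↥(W.divisionField 2 ⊔ IntermediateField.adjoin K ({i} : Set (AlgebraicClosure K))) 2)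
    (hκL : κL.IsCyclotomic) :
    BaseChangeModel.galImage K ↥(W.divisionField 2 ⊔ IntermediateField.adjoin K ({i} : Set (AlgebraicClosure K)))
        κL.kerSubgroup =
      (W.galoisRepTorsion 2).ker ⊓ (GaloisRep.cyclotomicCharacter K 2).toMonoidHom.ker := by
  haveI : NeZero ((2 : ℕ) : K) := ⟨by exact_mod_cast (two_ne_zero : (2 : K) ≠ 0)⟩
  -- membership in the range of the restriction: the elements fixing `K(E[2])` and `i`
  have hrange := FineSelmerFiniteOfUnramifiedClasses.range_absGaloisRestrict_eq_fixingSubgroup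
    (W.divisionField 2 ⊔ IntermediateField.adjoin K ({i} : Set (AlgebraicClosure K)))
  have hiL : i ∈ W.divisionField 2 ⊔ IntermediateField.adjoin K ({i} : Set (AlgebraicClosure K)) :=
    (le_sup_right : IntermediateField.adjoin K ({i} : Set (AlgebraicClosure K)) ≤ _)
      (IntermediateField.mem_adjoin_simple_self K i)
  unfold ZpExtension.IsCyclotomic at hκL
  ext g
  rw [BaseChangeModel.mem_galImage_iff, Subgroup.mem_inf, MonoidHom.mem_ker, MonoidHom.mem_ker]
  constructor
  · rintro ⟨σ, hσ, rfl⟩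
    have hmem : resGal (K := K) _ σ ∈ (absGaloisRestrict K
        ↥(W.divisionField 2 ⊔ IntermediateField.adjoin K ({i} : Set (AlgebraicClosure K)))).range := ⟨σ, rfl⟩
    rw [hrange] at hmem
    have hfixi : resGal (K := K) _ σ • i = i := by
      rw [absoluteGaloisGroup.smul_def]
      exact (IntermediateField.mem_fixingSubgroup_iff _ _).1 hmem i hiL
    have htors : GaloisRep.cyclotomicCharacter K 2 (resGal (K := K) _ σ) ∈ CommGroup.torsion ℤ_[2]ˣ := by
      rw [resGal_eq_absGaloisRestrict, cyclotomicCharacter_absGaloisRestrict]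
      have hσ' := hσ
      rw [hκL] at hσ'
      exact hσ'
    refine ⟨?_, ?_⟩
    · -- `res σ` fixes `E[2]`
      apply Multiplicative.toAdd.injective
      ext P
      rw [galoisRepTorsion_apply, resGal_smul_geomTorsion_two_eq_self W _ le_sup_left σ P]
      rfl
    · change GaloisRep.cyclotomicCharacter K 2 (resGal (K := K) _ σ) = 1
      exact cyclotomicCharacter_eq_one_of_smul_eq_self_of_mem_torsion i hi hfixi htors
  · rintro ⟨hρ, hχ⟩
    change GaloisRep.cyclotomicCharacter K 2 g = 1 at hχ
    -- `g` fixes `K(E[2])` and `i`, hence lies in the range of the restriction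
    have hfixE : absoluteGaloisGroup.toAlgEquiv K g ∈ (W.divisionField 2).fixingSubgroup := by
      have hg : g ∈ fixingSubgroupOfModule K (geomTorsion W ((2 : ℕ) : ℤ)) := by
        rw [W.mem_fixingSubgroupOfModule_geomTorsion_iff 2]
        intro T
        rw [← galoisRepTorsion_apply]
        have hρ' : W.galoisRepTorsion ((2 : ℕ) : ℤ) g = 1 := hρ
        rw [hρ']
        rfl
      have h := W.fixingSubgroup_divisionField 2
      rw [SetLike.ext_iff] at h
      exact (h g).2 hg
    have hfixi : absoluteGaloisGroup.toAlgEquiv K g ∈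
        (IntermediateField.adjoin K ({i} : Set (AlgebraicClosure K))).fixingSubgroup :=
      (mem_fixingSubgroup_adjoin_simple_iff i _).2 (smul_eq_self_of_cyclotomicCharacter_eq_one i hi hχ)
    have hfixL : absoluteGaloisGroup.toAlgEquiv K g ∈
        (W.divisionField 2 ⊔ IntermediateField.adjoin K ({i} : Set (AlgebraicClosure K))).fixingSubgroup := by
      rw [IntermediateField.fixingSubgroup_sup]
      exact ⟨hfixE, hfixi⟩
    have hmem : g ∈ (absGaloisRestrict K
        ↥(W.divisionField 2 ⊔ IntermediateField.adjoin K ({i} : Set (AlgebraicClosure K)))).range := by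
      rw [hrange]; exact hfixL
    obtain ⟨σ, hσ⟩ := hmem
    refine ⟨σ, ?_, hσ⟩
    rw [hκL, Subgroup.mem_comap]
    change GaloisRep.cyclotomicCharacter _ 2 σ ∈ CommGroup.torsion ℤ_[2]ˣ
    rw [← cyclotomicCharacter_absGaloisRestrict K, show absGaloisRestrict K _ σ = g from hσ, hχ]
    exact (CommGroup.torsion ℤ_[2]ˣ).one_mem


/-- **Lim 2017 Thm. 3.5 at `p = 2`, UPSTAIRS, for `E` over any number field `K`** (the typed shape, generic base): for `E = W/K`
elliptic and `i ∈ K̄` with `i² = −1`, if Iwasawa's classical `μ` vanishes (growth form) for every cyclotomic `ℤ₂`-extension of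
`L = K(E[2]) ⊔ K⟮i⟯`, then the classes of Greenberg's strict Selmer group for the fine data of `E[2^∞]` over
`K̄^{ker ρ̄_{E,2} ⊓ ker χ₂} = K(E[2], μ_{2^∞}) = L·K_∞` killed by `2` form a finite set. §2 over the totally complex base `L` (`Γ_L` fixes
`E[2]`; `L/K` normal) and the subgroup identity `galImage(ker κ_L) = ker ρ̄_{E,2} ⊓ ker χ₂`.
[cite: Lim2017FineSelmer, §3 Thm. 3.5 and proof of Thm. 3.1 (arXiv:1306.2047 pp. 6–7)] [cite: CoatesSujatha2005, §3 Thm. 3.4] -/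
theorem finite_strictFine_twoTorsion_upstairs_of_classicalMuVanishes (i : AlgebraicClosure K) (hi : i ^ 2 = -1)
    (hμ : ∀ κL : ZpExtension ↥(W.divisionField 2 ⊔ IntermediateField.adjoin K ({i} : Set (AlgebraicClosure K))) 2,
      κL.IsCyclotomic → ClassicalMuVanishes κL) :
    Set.Finite {c : W.subgroupH1 2 ((W.galoisRepTorsion 2).ker ⊓ (GaloisRep.cyclotomicCharacter K 2).toMonoidHom.ker) |
      c ∈ strictSelmerGroupOver ((W.galoisRepTorsion 2).ker ⊓ (GaloisRep.cyclotomicCharacter K 2).toMonoidHom.ker)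
          (W.geomPrimaryTorsion 2) 2 (fineData (W.geomPrimaryTorsion 2) 2) ∧ 2 • c = 0} := by
  -- the carrier `L = K(E[2]) ⊔ K⟮i⟯`: a totally complex normal number field
  have hint : IsIntegral K i := by
    refine ⟨Polynomial.X ^ 2 + 1, Polynomial.monic_X_pow_add_C _ two_ne_zero, ?_⟩
    simp [hi]
  haveI := IntermediateField.adjoin.finiteDimensional hint
  haveI : NumberField ↥(W.divisionField 2 ⊔ IntermediateField.adjoin K ({i} : Set (AlgebraicClosure K))) :=
    NumberField.of_module_finite K _
  haveI := normal_adjoin_of_sq_eq_neg_one i hi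
  have hLc : ∀ w : InfinitePlace ↥(W.divisionField 2 ⊔ IntermediateField.adjoin K ({i} : Set (AlgebraicClosure K))),
      w.IsComplex :=
    isComplex_of_mem_sq_eq_neg_one i hi _ ((le_sup_right : IntermediateField.adjoin K ({i} : Set (AlgebraicClosure K)) ≤ _)
      (IntermediateField.mem_adjoin_simple_self K i))
  -- a cyclotomic `ℤ₂`-extension of `L`
  obtain ⟨κL, hκL⟩ := ZpExtension.exists_isCyclotomic_holds
    (↥(W.divisionField 2 ⊔ IntermediateField.adjoin K ({i} : Set (AlgebraicClosure K)))) 2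
    (GaloisRep.cyclotomicCharacter_range_infinite _ 2)
  -- §2 in the subgroup model, the subgroup rewritten along the identity of §3
  exact finite_strictFine_pTorsion_galImage_of_classicalMuVanishes W hLc
    (resGal_smul_geomTorsion_two_eq_self W _ le_sup_left) κL hκL (hμ κL hκL) _
    (galImage_kerSubgroup_eq W i hi κL hκL).symm

end Two

end Literature.NumberTheory.EllipticCurves.FineSelmerUpstairs

/-! ## §4 The discharge -/

namespace Literature.NumberTheory.EllipticCurves.Lim2017

open NumberField Field WeierstrassCurve IntermediateField
open Literature.NumberTheory.EllipticCurves Literature.NumberTheory.EllipticCurves.GreenbergSelmer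
  Literature.NumberTheory.GaloisRepresentations Literature.NumberTheory.IwasawaTheory
  Literature.NumberTheory.EllipticCurves.FineSelmerUpstairs

/-- **Lim 2017, Thm. 3.5 at `p = 2`, upstairs, carrier `L = ℚ(E[2], √−1)` — DISCHARGE of the named fact
`thm35_at_two_upstairs_fineSelmer_twoTorsion_finite_of_classicalMuVanishes`** (typed in `FineSelmerClassGroupCriterion.lean` by cell
bsd-f1-sign2): for every elliptic `W/ℚ` and `i² = −1`, Iwasawa's classical `μ₂ = 0` (growth form) for every cyclotomic `ℤ₂`-extension
of `ℚ(E[2]) ⊔ ℚ⟮i⟯` implies that the fine Selmer group of `E[2^∞]` over `ℚ(E[2], μ_{2^∞}) = ℚ̄^{ker ρ̄_{E,2} ⊓ ker χ₂}` has finite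
`2`-torsion. Proof: §2 over the totally complex base `L` (no real place, no `2`-extension step — exactly the carrier
`F(μ_{2p}, T/𝔪T)` of Lim's printed proof) and the subgroup identity of §3. Net effect: the «if» direction typed by the tree is a
KERNEL theorem; consumers (`…FineRoadLimRelUpstairs.limRelAtTwo_of_lim2017`, crux 202's `stub_lemma46_limUp.2`, the relaxed `(A₂)`
doors of B7′ 23921) hold with `hLim` DISCHARGED. Nothing about BSD. [cite: Lim2017FineSelmer, §3 Thm. 3.5, Lemma 3.2 and proof of Thm. 3.1 (arXiv:1306.2047 pp. 6–7)]
[cite: CoatesSujatha2005, §3 Thm. 3.4 and Lemma 3.3] [cite: Lang1990, Ch. 5 §1 Thm. 1.2 (iii), §4 pp. 137–143] -/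
theorem thm35_at_two_upstairs_fineSelmer_twoTorsion_finite_of_classicalMuVanishes_holds :
    thm35_at_two_upstairs_fineSelmer_twoTorsion_finite_of_classicalMuVanishes :=
  fun W _ i hi hμ ↦ finite_strictFine_twoTorsion_upstairs_of_classicalMuVanishes W i hi hμ

end Literature.NumberTheory.EllipticCurves.Lim2017

end
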